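import Literature.NumberTheory.Automorphic.Liu2021.AdelicOscillatorNonvanishing
import Literature.NumberTheory.Automorphic.Liu2021.LemD1AsPrinted
import HarnessLib

/-!
# [Liu2021] Def. 4.11 (`⊗'`) + App. D Lem. D.1 (1) AS PRINTED ⟹ `ω(μ,ε,χ) ≠ 0` for `n ≥ 3` — one name per consumer shape

Reproduction (Literature): the composition, BY NAME and with nothing else, of two tree files —

* `AdelicOscillatorNonvanishing.lean` (p299697): Def. 4.11's construction «`ω(μ,ε,χ) := ⊗'_v ω(μ_v,ε_v,χ_v)`» (l. 2094
  of `FJcycle.tex`, arXiv:2102.11518 v2, md5 `6db49a74122d`), presented as a restricted tensor product in the tree's sense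
  (`IsRestrictedTensorProduct`), of local spaces each satisfying the tree's local record
  `LocalOscillatorDatum.IrreducibleAdmissible` with `rank ≠ 2` ⟹ `ω(μ,ε,χ)` is a non-zero space; and
* `LemD1AsPrinted.lean`: [Liu2021] App. D Lem. D.1, first sentence + (1), EXACTLY AS PRINTED (l. 5226–5229) over the local
  datum `LemD1Data F E n V` (REAL non-archimedean local field `F`, the tree's hardened standing data
  `OscillatorStandingData F E n` — étale `E/F` of rank 2 with its involution `c`, the hermitian space `(Eⁿ, gram)`,
  `U(V)(F)`, `E¹`, `χ̌` —, `ε`, `μ`, `χ`, the carrier `ω(μ, ε)` on `V`, and the CONSTRUCTED maximal `χ`-quotient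
  `ω(μ, ε, χ) = V ⧸ augmentation ω scalar χ`), with its kernel-checked projection
  `LemD1_1AsPrinted.irreducibleAdmissible : LemD1_1AsPrinted L → L.datum.IrreducibleAdmissible` onto the tree's local
  record N-f1 —

so that a consumer citing Lem. D.1 (1) AS PRINTED at every finite place writes ONE name:

* `Thm418Data.nontrivial_omega_of_lemD1AsPrinted` — local data `L v : LemD1Data (Fl v) (El v) D.n (Vl v)` of rank `D.n`
  at every finite place `v`, with `(hD1 : ∀ v, LemD1_1AsPrinted (L v))`, `3 ≤ D.n`, and the `⊗'` presentation `j` of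
  `D.omega ε χ` by the local quotient spaces `Vl v ⧸ augmentation (L v).omega (L v).S.scalar (L v).chi` ⟹
  `Nontrivial (D.omega ε χ)`;
* `Thm418Data.isIrreducible_rhoAt_of_lemD1AsPrinted` — with `Def411AsPrinted D`: EXACTLY the stage-2 junctions' binder
  `hirr` at an index `i`, every input cite-as-printed ([Liu2021] Def. 4.11; App. D Lem. D.1 (1)) or a carrier presentation;
* `Thm418Data.exists_obj_homK_ne_zero_of_asPrinted_of_lemD1AsPrinted` (+ `_le_` below a prescribed open compact `K′`;
  `exists_homK_ne_zero_le_of_def411_of_lemD1AsPrinted` for a prescribed object `D_μ`) — the whole supply-side chain: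
  Thm. 4.18 + Prop. 4.6 (1) + Def. 4.11 + Lem. D.1 (1), ALL AS PRINTED, + the `⊗'` presentation of one admissible `ω_i` +
  `3 ≤ n` ⟹ `Hom_E(A_K, A_μ)_ℚ ∋ φ ≠ 0` at small level.

T5: the binder sets below are those of p299697 with `hD1` replaced by the as-printed record; the former are jointly
inhabited in the kernel (`Thm418Data.localOscillator_hypotheses_consistent`); inhabitation of `LemD1_1AsPrinted` at a
real local datum is the record file's concern and is not re-proved here.  Theorems only; no definition, no axiom; every
declaration is proved; axioms ⊆ {propext, Classical.choice, Quot.sound}.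

References (context): Y. Liu, *Fourier–Jacobi cycles and arithmetic relative trace formula*, Camb. J. Math. 9 (2021) =
arXiv:2102.11518 — Def. 4.11 l. 2083–2097, Thm. 4.18 l. 2232–2245, Prop. 4.6 (1) l. 1969, App. D §D.1 l. 5209–5224 and
Lem. D.1 l. 5226–5238; D. Flath, Proc. Sympos. Pure Math. 33 (1979) part 1, §2.
-/

noncomputable section

open NumberField CategoryTheory
open Literature.RepresentationTheory.CentralCharacterQuotient (augmentation)
open scoped RestrictedProduct

namespace Literature.NumberTheory.Automorphic.Liu2021

namespace Thm418Data

universe uP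

variable {F E : Type} [Field F] [NumberField F] [IsTotallyReal F] [Field E] [NumberField E] [Algebra F E]
  [IsTotallyComplex E] [Algebra.IsQuadraticExtension F E] {D : Thm418Data F E}

variable {P : Type uP} [DecidableEq P] {Fl El Vl : P → Type} [∀ v, Field (Fl v)] [∀ v, ValuativeRel (Fl v)]
  [∀ v, TopologicalSpace (Fl v)] [∀ v, CommRing (El v)] [∀ v, Algebra (Fl v) (El v)] [∀ v, TopologicalSpace (El v)]
  [∀ v, AddCommGroup (Vl v)] [∀ v, Module ℂ (Vl v)] {L : ∀ v, LemD1Data (Fl v) (El v) D.n (Vl v)}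
  {x₀ : ∀ v, Vl v ⧸ augmentation (L v).omega (L v).S.scalar (L v).chi} {S₀ : Finset P}

/-- **`ω(μ, ε, χ) ≠ 0` for `n ≥ 3`, Lem. D.1 (1) cited AS PRINTED at every finite place.**  The carrier `D.omega ε χ`
presented as Def. 4.11 prints it — the restricted tensor product `j` of the maximal `χ_v`-quotients
`Vl v ⧸ augmentation … = ω(μ_v, ε_v, χ_v)` of local data `L v : LemD1Data (Fl v) (El v) D.n (Vl v)` (App. D §D.1 on REAL
local objects, rank `n = D.n` at every finite place) — with `LemD1_1AsPrinted (L v)` for every `v` and `3 ≤ D.n`: the space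
`ω(μ,ε,χ)` is non-trivial.  (`nontrivial_omega_of_localOscillator` ∘ `LemD1_1AsPrinted.irreducibleAdmissible`.)
[cite: Liu2021, Def. 4.11 and App. D Lem. D.1 (1)] -/
theorem nontrivial_omega_of_lemD1AsPrinted {ε : D.Eps} {χ : D.Chi} (hD1 : ∀ v, Liu2021.LemD1_1AsPrinted (L v))
    (hn : 3 ≤ D.n)
    {j : RestrictedFamily (fun v => Vl v ⧸ augmentation (L v).omega (L v).S.scalar (L v).chi) x₀ → D.omega ε χ}
    (hj : IsRestrictedTensorProduct ℂ j S₀) : Nontrivial (D.omega ε χ) :=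
  nontrivial_omega_of_localOscillator (fun v => (L v).datum) (fun v => (hD1 v).irreducibleAdmissible)
    (fun _ => rfl) hn hj

/-- **`hirr` from as-printed inputs only**: `Def411AsPrinted D` ([Liu2021] Def. 4.11 as printed) + `LemD1_1AsPrinted (L v)`
at every finite place (App. D Lem. D.1 (1) as printed) + the `⊗'` presentation of `ω_i` + `3 ≤ n` ⟹ `(D.rhoAt i).IsIrreducible`
(Mathlib's sense, non-vanishing included). [cite: Liu2021, Def. 4.11 and App. D Lem. D.1 (1)] -/
theorem isIrreducible_rhoAt_of_lemD1AsPrinted (h411 : Liu2021.Def411AsPrinted D) (i : D.AdmIndex)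
    (hD1 : ∀ v, Liu2021.LemD1_1AsPrinted (L v)) (hn : 3 ≤ D.n)
    {j : RestrictedFamily (fun v => Vl v ⧸ augmentation (L v).omega (L v).S.scalar (L v).chi) x₀ → D.omegaAt i}
    (hj : IsRestrictedTensorProduct ℂ j S₀) : (D.rhoAt i).IsIrreducible :=
  isIrreducible_rhoAt_of_localOscillator h411 i (fun v => (L v).datum) (fun v => (hD1 v).irreducibleAdmissible)
    (fun _ => rfl) hn hj

/-- **Thm. 4.18 + Prop. 4.6 (1) + Def. 4.11 + Lem. D.1 (1), ALL AS PRINTED ⟹ for some object `D_μ ∈ 𝒜(μ)`,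
`Hom_E(A_K, A_μ)_ℚ ∋ φ ≠ 0` at every open compact `K` below some open compact `K₀`** — given one `μ`-admissible index `i`
whose `ω_i` is presented as the restricted tensor product of the spaces of local data `L v` with `(L v).rank = D.n`, and
`3 ≤ D.n`. [cite: Liu2021, Thm. 4.18 (1), Prop. 4.6 (1), Def. 4.11 and App. D Lem. D.1 (1)] -/
theorem exists_obj_homK_ne_zero_of_asPrinted_of_lemD1AsPrinted {𝒜 : SmallCategory D.Obj}
    (h : Liu2021.Thm418AsPrinted D) (h46 : Liu2021.Prop46_1AsPrinted D 𝒜) (h411 : Liu2021.Def411AsPrinted D)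
    (i : D.AdmIndex) (hD1 : ∀ v, Liu2021.LemD1_1AsPrinted (L v)) (hn : 3 ≤ D.n)
    {j : RestrictedFamily (fun v => Vl v ⧸ augmentation (L v).omega (L v).S.scalar (L v).chi) x₀ → D.omegaAt i}
    (hj : IsRestrictedTensorProduct ℂ j S₀) :
    ∃ (Dμ : D.Obj) (K₀ : Subgroup D.G), IsOpenCompact K₀ ∧
      ∀ K : Subgroup D.G, IsOpenCompact K → K ≤ K₀ → ∃ φ : D.HomK K Dμ, φ ≠ 0 :=
  exists_obj_homK_ne_zero_of_asPrinted_of_localOscillator h h46 h411 i (fun v => (L v).datum)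
    (fun v => (hD1 v).irreducibleAdmissible) (fun _ => rfl) hn hj

/-- The same **below a prescribed open compact `K′`**. [cite: Liu2021, Thm. 4.18 (1), Prop. 4.6 (1), Def. 4.11 and App. D Lem. D.1 (1)] -/
theorem exists_obj_homK_ne_zero_le_of_asPrinted_of_lemD1AsPrinted {𝒜 : SmallCategory D.Obj}
    (h : Liu2021.Thm418AsPrinted D) (h46 : Liu2021.Prop46_1AsPrinted D 𝒜) (h411 : Liu2021.Def411AsPrinted D)
    (i : D.AdmIndex) (hD1 : ∀ v, Liu2021.LemD1_1AsPrinted (L v)) (hn : 3 ≤ D.n)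
    {j : RestrictedFamily (fun v => Vl v ⧸ augmentation (L v).omega (L v).S.scalar (L v).chi) x₀ → D.omegaAt i}
    (hj : IsRestrictedTensorProduct ℂ j S₀) {K' : Subgroup D.G} (hK' : IsOpenCompact K') :
    ∃ (Dμ : D.Obj) (K : Subgroup D.G), IsOpenCompact K ∧ K ≤ K' ∧ ∃ φ : D.HomK K Dμ, φ ≠ 0 :=
  exists_obj_homK_ne_zero_le_of_asPrinted_of_localOscillator h h46 h411 i (fun v => (L v).datum)
    (fun v => (hD1 v).irreducibleAdmissible) (fun _ => rfl) hn hj hK'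

/-- **A prescribed object `D_μ`, below a prescribed level**, Lem. D.1 (1) cited as printed.
[cite: Liu2021, Thm. 4.18 (1), Def. 4.11 and App. D Lem. D.1 (1)] -/
theorem exists_homK_ne_zero_le_of_def411_of_lemD1AsPrinted (h : Liu2021.Thm418AsPrinted D)
    (h411 : Liu2021.Def411AsPrinted D) (Dμ : D.Obj) (i : D.AdmIndex) (hD1 : ∀ v, Liu2021.LemD1_1AsPrinted (L v))
    (hn : 3 ≤ D.n)
    {j : RestrictedFamily (fun v => Vl v ⧸ augmentation (L v).omega (L v).S.scalar (L v).chi) x₀ → D.omegaAt i}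
    (hj : IsRestrictedTensorProduct ℂ j S₀) {K' : Subgroup D.G} (hK' : IsOpenCompact K') :
    ∃ K : Subgroup D.G, IsOpenCompact K ∧ K ≤ K' ∧ ∃ φ : D.HomK K Dμ, φ ≠ 0 :=
  exists_homK_ne_zero_le_of_def411_of_localOscillator h h411 Dμ i (fun v => (L v).datum)
    (fun v => (hD1 v).irreducibleAdmissible) (fun _ => rfl) hn hj hK'

end Thm418Data

end Literature.NumberTheory.Automorphic.Liu2021

end
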